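import Mathlib
import Literature.RingTheory.MvPolynomial.GrobnerDegeneration

/-!
# TropicalLinks / SchonResolves — the extended ideal `I·k[t][x]` and its `t`-slices

Route `ResolutionOfSingularities/TropicalLinks`, crux `SchonResolves`
(stmt-ResolutionOfSingularities-17234), line `zariski-toric-closure`, sub-brick of KERNEL (P1)
("the Gröbner degeneration is free over `k[t]` with basis the standard monomials", Eisenbud,
*Commutative Algebra*, Thm. 15.17).  For an ideal `I ⊆ k[x_σ]` and a set of parameters `t_ι`,
the extension `I^e = I.map (map C) ⊆ k[t_ι][x_σ]` of `I` to the polynomial ring over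
`k[t_ι] = MvPolynomial ι k` is described coefficientwise:

* `schonResolves_coeff_commAlgEquiv` — the `t^e`-coefficient of `g ∈ k[t][x]` read in `k[x][t]`
  (Mathlib's `MvPolynomial.commAlgEquiv`) is the SLICE `Σ_a [t^e]([x^a] g) · x^a`;
* `schonResolves_mem_map_map_C_iff_commAlgEquiv` — `g ∈ I^e ↔ commAlgEquiv g ∈ I.map C`;
* `schonResolves_mem_map_map_C_iff_forall_slice` (registered stub) — **`g ∈ I^e` iff every
  `t`-slice of `g` lies in `I`**;
* `schonResolves_mem_map_map_C_of_mul_C_prod_X_pow_mem` — hence **`I^e` is saturated with respect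
  to `∏ tᵢ`** (and to every monomial in `t`).

Elementary commutative algebra (`k[t][x] ≅ k[x][t] = ⊕_e k[x]·t^e` and `I^e = ⊕_e I·t^e`);
no new definitions.
-/

-- single-problem summit: the doubled namespace component `ResolutionOfSingularities` is forced
set_option linter.dupNamespace false

namespace Summit.ResolutionOfSingularities.ResolutionOfSingularities.Theorems

open MvPolynomial

section MapCSlice

variable {k : Type} [CommRing k] {σ ι : Type}

/-- `commAlgEquiv` swaps nested monomials: `x^a · t^e ↦ t^e · x^a`. [folklore] -/
theorem schonResolves_commAlgEquiv_monomial_monomial (a : σ →₀ ℕ) (e : ι →₀ ℕ)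
    (r : k) : commAlgEquiv k σ ι (monomial a (monomial e r)) = monomial e (monomial a r) :=
  AddMonoidAlgebra.commAlgEquiv_single_single a e r

/-- **The `t^e`-coefficient of `g ∈ k[t][x]`, read in `k[x][t]`, is the slice
`Σ_a [t^e]([x^a] g) · x^a`.** [folklore] -/
theorem schonResolves_coeff_commAlgEquiv (g : MvPolynomial σ (MvPolynomial ι k))
    (e : ι →₀ ℕ) :
    coeff e (commAlgEquiv k σ ι g) = ∑ a ∈ g.support, monomial a (coeff e (coeff a g)) := by
  classical
  conv_lhs => rw [g.as_sum, map_sum, coeff_sum]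
  refine Finset.sum_congr rfl fun a _ => ?_
  conv_lhs => rw [(coeff a g).as_sum, map_sum, map_sum, coeff_sum]
  simp only [schonResolves_commAlgEquiv_monomial_monomial, coeff_monomial, Finset.sum_ite_eq']
  split_ifs with h
  · rfl
  · rw [notMem_support_iff.mp h, map_zero]

/-- The coefficients of `commAlgEquiv g`: `[x^a][t^e] (commAlgEquiv g) = [t^e][x^a] g`.
[folklore] -/
theorem schonResolves_coeff_coeff_commAlgEquiv [DecidableEq σ]
    (g : MvPolynomial σ (MvPolynomial ι k)) (e : ι →₀ ℕ) (a : σ →₀ ℕ) :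
    coeff a (coeff e (commAlgEquiv k σ ι g)) = coeff e (coeff a g) := by
  rw [schonResolves_coeff_commAlgEquiv, coeff_sum]
  simp only [coeff_monomial, Finset.sum_ite_eq']
  split_ifs with h
  · rfl
  · rw [notMem_support_iff.mp h, coeff_zero]

/-- `commAlgEquiv ∘ (map C) = C`: constants-in-`t` of `k[t][x]` are the constants of `k[x][t]`.
[folklore] -/
theorem schonResolves_commAlgEquiv_comp_map_C :
    (commAlgEquiv k σ ι :
        MvPolynomial σ (MvPolynomial ι k) →+* MvPolynomial ι (MvPolynomial σ k)).comp
      (MvPolynomial.map (C : k →+* MvPolynomial ι k)) = C := by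
  refine ringHom_ext (fun r => ?_) (fun s => ?_)
  · simp [map_C, commAlgEquiv_C]
  · simp [map_X, commAlgEquiv_X]

/-- `commAlgEquiv` carries the extended ideal `I^e = I.map (map C) ⊆ k[t][x]` to
`I.map C ⊆ k[x][t]`. [folklore] -/
theorem schonResolves_map_commAlgEquiv_map_map_C (I : Ideal (MvPolynomial σ k)) :
    (I.map (MvPolynomial.map (C : k →+* MvPolynomial ι k))).map
      (commAlgEquiv k σ ι :
        MvPolynomial σ (MvPolynomial ι k) →+* MvPolynomial ι (MvPolynomial σ k)) =
      I.map C := by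
  rw [Ideal.map_map, schonResolves_commAlgEquiv_comp_map_C]

/-- **`g ∈ I^e ↔ commAlgEquiv g ∈ I.map C`.** [folklore] -/
theorem schonResolves_mem_map_map_C_iff_commAlgEquiv (I : Ideal (MvPolynomial σ k))
    (g : MvPolynomial σ (MvPolynomial ι k)) :
    g ∈ I.map (MvPolynomial.map (C : k →+* MvPolynomial ι k)) ↔
      commAlgEquiv k σ ι g ∈
        I.map (C : MvPolynomial σ k →+* MvPolynomial ι (MvPolynomial σ k)) := by
  rw [← schonResolves_map_commAlgEquiv_map_map_C I, Ideal.map_coe]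
  exact (Ideal.apply_mem_of_equiv_iff (f := (commAlgEquiv k σ ι).toRingEquiv)).symm

/-- **`I^e = I.map (map C)` is saturated with respect to every monomial of `t`**: if
`g · t^d ∈ I^e` then `g ∈ I^e`. [folklore] -/
theorem schonResolves_mem_map_map_C_of_mul_C_monomial_mem (I : Ideal (MvPolynomial σ k))
    (d : ι →₀ ℕ) {g : MvPolynomial σ (MvPolynomial ι k)}
    (h : g * C (monomial d (1 : k)) ∈ I.map (MvPolynomial.map (C : k →+* MvPolynomial ι k))) :
    g ∈ I.map (MvPolynomial.map (C : k →+* MvPolynomial ι k)) := by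
  have h' := (schonResolves_mem_map_map_C_iff_commAlgEquiv I _).mp h
  rw [map_mul, commAlgEquiv_C, map_monomial, C_1] at h'
  refine (schonResolves_mem_map_map_C_iff_commAlgEquiv I g).mpr
    (mem_map_C_iff.mpr fun e => ?_)
  have h'' := mem_map_C_iff.mp h' (e + d)
  rwa [coeff_mul_monomial, mul_one] at h''

/-- **`I^e` is saturated with respect to `∏ tᵢ`**: if `g · (∏ tᵢ)^M ∈ I^e` then
`g ∈ I^e`. [folklore] -/
theorem schonResolves_mem_map_map_C_of_mul_C_prod_X_pow_mem [Fintype ι]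
    (I : Ideal (MvPolynomial σ k)) (M : ℕ) {g : MvPolynomial σ (MvPolynomial ι k)}
    (h : g * C (∏ i, X i : MvPolynomial ι k) ^ M ∈
      I.map (MvPolynomial.map (C : k →+* MvPolynomial ι k))) :
    g ∈ I.map (MvPolynomial.map (C : k →+* MvPolynomial ι k)) := by
  have hprod : (∏ i, X i : MvPolynomial ι k) = monomial (∑ i, Finsupp.single i 1) 1 :=
    (monomial_sum_one _ _).symm
  rw [hprod, ← map_pow, monomial_pow, one_pow] at h
  exact schonResolves_mem_map_map_C_of_mul_C_monomial_mem I _ h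

/-- **Membership in the extended ideal is read slice by slice**: for an ideal `I ⊆ k[x_σ]` and
`g ∈ k[t_ι][x_σ]`, `g ∈ I^e = I.map (map C)` iff for every exponent `e` the `t^e`-slice
`Σ_a [t^e]([x^a] g) · x^a ∈ k[x_σ]` of `g` lies in `I` (`k[t][x] = ⊕_e k[x]·t^e` and
`I^e = ⊕_e I·t^e`). [folklore] -/
theorem schonResolves_mem_map_map_C_iff_forall_slice : ∀ (k : Type) [Field k] (σ ι : Type)
    (I : Ideal (MvPolynomial σ k)) (g : MvPolynomial σ (MvPolynomial ι k)),
    g ∈ I.map (MvPolynomial.map (MvPolynomial.C : k →+* MvPolynomial ι k)) ↔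
      ∀ e : ι →₀ ℕ, (∑ a ∈ g.support,
        MvPolynomial.monomial a (MvPolynomial.coeff e (MvPolynomial.coeff a g))) ∈ I := by
  intro k _ σ ι I g
  rw [schonResolves_mem_map_map_C_iff_commAlgEquiv, mem_map_C_iff]
  simp only [schonResolves_coeff_commAlgEquiv]

end MapCSlice

end Summit.ResolutionOfSingularities.ResolutionOfSingularities.Theorems
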